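/-
Copyright (c) 2026 the pub-hodgecm-mathlib formalisation cell (harness21).  Prover seat hodgecm-mathlib-LH4-p18 (g3), Track A «FOUR-FRAME» hand on VALVE loan to
Track B «K2-LIT», #184♮ = hLiu418 = `stmt-HodgeConjecture-24832`; desk K2Liu-p14 (g4) DESK WORD #6 (b) ∕ HANDOFF memo :16, task (P-supp-lat), file (lat-d): the LOCAL
payer of the one by-value letter `hloc` of ★ p863726 (lat-c) `K2LiuKindOneLineLatticeLetters.hlatU_of_latticeLocal`, at the socket rank `n = 2` — PRELIMINARIES
(§1–§6: unit defects, conductor exponents, `e ≤ 2`, Gram letters, the test step, valuation bookkeeping); the head is the sequel `K2LiuKindOneLineLatticeLocal`.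
THEOREMS ONLY (no `def`, no `instance`, no notation, no named-fact hypothesis, no `sorry`).
-/
import Summits.HodgeConjecture.HodgeConjecture.Theorems.K2LiuKindOneLineLatticeLetters            -- ★ (lat-c) `hlatU_of_latticeLocal` (+ the K2Lit frame, `unifAt`, `valuation_unifAt_le_one`)
import Summits.HodgeConjecture.HodgeConjecture.Theorems.K2LiuUnipotentDeepLevel                   -- ★ (lat-a) ED.2 `nElem_apply_mem_congruenceGL_pow_of_two`
import Summits.HodgeConjecture.HodgeConjecture.Theorems.K2LiuKindOneLineCharacterBoundTwoGeneral  -- ★ p863515 `valued_entry_mul_le_of_forall_test`; brings ★ p863078 `skew_test··`, `valued_toPlace_le_exp_mul`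
import Summits.HodgeConjecture.HodgeConjecture.Theorems.K2LiuRankOneCornerCharacterReading        -- ★ `unipDeltaChar_locToAdelic_nElem`; brings ★ `K2LiuUnipDeltaLocBridge`, ★ `K2LiuTateCharacterLocalTrace`
import Summits.HodgeConjecture.HodgeConjecture.Theorems.K2LiuSiegelUnipotentLocalDefs             -- ★ `locToAdelic_mem_unipDelta`
import Summits.HodgeConjecture.HodgeConjecture.Theorems.K2LiuBadPlaceLocalFactorSkew              -- ★ `exists_hasConductorExp_adeleAddCharAt`
import Summits.HodgeConjecture.HodgeConjecture.Theorems.K2LiuKindWGoodPlaceFactor                 -- ★ `gramS_eq_map` (`gramS = (T^R ⊗ L) ⊗ 1` at rank 2)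
import Literature.NumberTheory.Automorphic.GlobalAdditiveCharacterProofs                           -- ★ `Tate1950_adicComponent_adeleAddChar_holds`
import Literature.NumberTheory.Automorphic.QuadraticAdeleBaseChange                                -- ★ `UnitaryGroup.eventually_valued_algebraMap_eq_one`
import Literature.NumberTheory.Automorphic.AdeleBaseChange                                         -- ★ `HeightOneSpectrum.tendsto_under_cofinite`
import Literature.NumberTheory.Automorphic.UnitaryGroupDoubledBigCellNonsplit                      -- ★ `conjLocal_conjLocal`
import Literature.NumberTheory.GelbartRogawski1991.LocalKudlaSplittingInjectiveTransported         -- ★ `gramR_eq_diagonal`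
import Literature.NumberTheory.K2Lit.LocalSiegelIntertwining                                       -- ★ `nElem_mem_unipDeltaLocal`
import Mathlib.NumberTheory.RamificationInertia.Basic
import HarnessLib

/-!
# Crux `HLiu418`, socket #42F′ (kind-one line term), file (lat-d′) — `K2LiuKindOneLineLatticeLocalPrelims`:
# TOOLS FOR THE LOCAL LATTICE LETTER `hloc` OF ★ (lat-c) AT `n = 2` (the head `exists_latticeLocal` ∕ `hlatU_holds` is the sequel `K2LiuKindOneLineLatticeLocal`)

Cell `hodgecm-mathlib`, crux item hLiu418 = `stmt-HodgeConjecture-24832` (helper lane `--supports … --as helper`, count-neutral), route of record `HCCMUnconditional`;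
squad K2 ∕ K2Liu, road `K2_Liu`, desk K2Liu-p14 DESK WORD #6 (b): `hlatU` of ★ p863630 `K2LiuKindOneLineTermOfRecord` is ★ (lat-c) `hlatU_of_latticeLocal` applied to ONE
by-value local letter `hloc`; the sequel pays `hloc` at the socket rank `n = 2` (`e : Fin N × Fin M ≃ Fin 2`) and closes `hlatU` unconditionally; THIS FILE holds its tools.

THE LOCAL LETTER (★ (lat-c), slope 2, `w`-indexed defect): `∃ D Bad, (∀ w ∉ Bad, D w = 0) ∧ ∀ v (w ∣ v) (Mv : ℕ) (S ∈ Skew(T^R ⊗ L))`, IF `χ_S(ι_v u) = 1` for every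
`u ∈ H(L⁺_v)` with all components `u_{w′} ∈ K_{w′}(ϖ_{w′}^{Mv})` and `ι_v u ∈ N_Δ(𝔸)`, THEN `|S_{ab}|_w ≤ exp(2·Mv + D_w)` for all entries.
THE PROOF (in the sequel, with the tools below).  Test `χ_S` on the local Siegel unipotents `u := n(t)` (★ `nElem`) of the four elementary `T^R`-skew test blocks `t` of ★ p863078 §2 (`skew_test01/10/00/11`)
at `v`-depth `N := Mv + 2(c_w + c_{c⁻¹•w})` (`c` = the sum of the unit defects of `2`, `δ_L`, `g₀ = T^R₀₀`, `g₁ = T^R₁₁`, §1):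
* DEPTH (§5): every `w′`-entry of `t` has valuation `≤ |2|_{w′}·|ϖ_{w′}|^{Mv}` (`|ι_v u|_{w′} = |u|_v^{e} ≤ exp(−N)`), so `n(t)_{w′} ∈ K_{w′}(ϖ_{w′}^{Mv})` at EVERY place,
  dyadic included (★ (lat-a) ED.2 `nElem_apply_mem_congruenceGL_pow_of_two`);
* MEMBERSHIP: `ι_v n(t) ∈ N_Δ(𝔸)` (★ `nElem_mem_unipDeltaLocal`, ★ `mem_unipDeltaLoc_iff_mem_unipDeltaLocal`, ★ `locToAdelic_mem_unipDelta`);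
* READING: `χ_S(ι_v n(t)) = ψ_v(Tr_{L⊗L⁺_v/L⁺_v}(−½·tr(S t)))` (★ `unipDeltaChar_locToAdelic_nElem`) — so the premise of `hloc` yields the four `htest··` letters of
  ★ p863515 `valued_entry_mul_le_of_forall_test` (`ψ := ψ_v` of conductor exponent `d_v`, §2; `τ := Tr`, ★ `toLocalRing_algebraTrace`, `algebraTrace_toLocalRing_mul`),
  whose conclusion `|2|_w|δ|_w|S_{ab}|_w ≤ max(|δ|_w,1)·exp(e(w|v)(N − d_v))` with `e(w|v) ≤ [L:L⁺] = 2` (§3) gives `|S_{ab}|_w ≤ exp(2Mv + D_w)`,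
  `D_w := c₂(w) + 2c_δ(w) + 4(c_w + c_{c⁻¹•w}) + 2|d_{w∩L⁺}|`, zero off a finite set (units a.e. ★ `eventually_valued_algebraMap_eq_one`, conductor `0` a.e. ★ Tate,
  ★ `tendsto_under_cofinite`) (§6).
[Shimura1997, §18.4, §20.1] [MoeglinWaldspurger1995, I.2.6, II.1.7] [Tate1950, §2.2, §4.1] [PlatonovRapinchuk1994, §5.1].
HONEST LABEL.  Count-neutral helpers, close no socket; with ★ (lat-c) this pays DESK WORD #6 (b) `hlatU` in full: `HC_CM` is proved only modulo the 7 printed citations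
(2 remaining named inputs: hLiu418 = `stmt-HodgeConjecture-24832`, h413 = `stmt-HodgeConjecture-24833`) until rung 0 closes.

## References
* [Shimura1997] G. Shimura, *Euler Products and Eisenstein Series*, CBMS 93 (1997): §18.4 (Fourier coefficients along the Siegel unipotent), §20.1 (denominators).
* [MoeglinWaldspurger1995] C. Moeglin, J.-L. Waldspurger, *Spectral Decomposition and Eisenstein Series* (1995): I.2.6 (Fourier expansion along `N(F)\N(𝔸)`), II.1.7.
* [Tate1950] J. Tate, *Fourier analysis in number fields and Hecke's zeta-functions* (1950): §2.2 (local additive characters, conductor), §4.1 (almost all unramified).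
* [PlatonovRapinchuk1994] V. Platonov, A. Rapinchuk, *Algebraic Groups and Number Theory* (1994): §5.1 (principal congruence subgroups).
-/

set_option autoImplicit false
set_option linter.dupNamespace false -- the mandated namespace repeats `HodgeConjecture.HodgeConjecture`

noncomputable section

open scoped NNReal MatrixGroups Matrix
open NumberField IsDedekindDomain Matrix ValuativeRel Filter
open Literature.NumberTheory.Automorphic Literature.NumberTheory.Automorphic.UnitaryGroup Literature.NumberTheory.GaloisRepresentations
open Literature.NumberTheory.GelbartRogawski1991 Literature.NumberTheory.GelbartRogawski1991.GRConstruction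
open Literature.NumberTheory.GelbartRogawski1991.AdaptedBlocks
open Literature.NumberTheory.GelbartRogawski1991.UnitaryDualPair Literature.NumberTheory.GelbartRogawski1991.UnitaryDualPair.LocalSplitting
open Literature.NumberTheory.K2Lit Literature.NumberTheory.K2Lit.SiegelDoubled Literature.NumberTheory.K2Lit.LocalSiegelDoubled
open Summit.HodgeConjecture.HodgeConjecture.Cruxes.HLiu418.K2LiuSiegelUnipotentFourierDefs (unipDeltaChar skewMatrices mem_skewMatrices_iff)
open Summit.HodgeConjecture.HodgeConjecture.Cruxes.HLiu418.K2LiuSiegelUnipotentLocalDefs (locToAdelic_mem_unipDelta)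
open Summit.HodgeConjecture.HodgeConjecture.Cruxes.HLiu418.K2LiuUnipDeltaLocBridge (mem_unipDeltaLoc_iff_mem_unipDeltaLocal)
open Summit.HodgeConjecture.HodgeConjecture.Cruxes.HLiu418.K2LiuLocalLFactorDefs (unifAt valued_unifAt)
open Summit.HodgeConjecture.HodgeConjecture.Cruxes.HLiu418.K2LiuKindOneLineLatticeLetters (valuation_unifAt_le_one hlatU_of_latticeLocal)
open Summit.HodgeConjecture.HodgeConjecture.Cruxes.HLiu418.K2LiuUnipotentDeepLevel (nElem_apply_mem_congruenceGL_pow_of_two)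
open Summit.HodgeConjecture.HodgeConjecture.Cruxes.HLiu418.K2LiuKindOneLineCharacterReading (algebraMap_localRing_apply)
open Summit.HodgeConjecture.HodgeConjecture.Cruxes.HLiu418.K2LiuKindOneLineCharacterBoundTwo (skew_test01 skew_test10 skew_test00 skew_test11 valued_toPlace_le_exp_mul)
open Summit.HodgeConjecture.HodgeConjecture.Cruxes.HLiu418.K2LiuKindOneLineCharacterBoundTwoGeneral (valued_entry_mul_le_of_forall_test)
open Summit.HodgeConjecture.HodgeConjecture.Cruxes.HLiu418.K2LiuRankOneCornerCharacterReading (unipDeltaChar_locToAdelic_nElem)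
open Summit.HodgeConjecture.HodgeConjecture.Cruxes.HLiu418.K2LiuTateCharacterLocalTrace (toLocalRing_algebraTrace algebraTrace_toLocalRing_mul)
open Summit.HodgeConjecture.HodgeConjecture.Cruxes.HLiu418.K2LiuBadPlaceLocalFactorSkew (exists_hasConductorExp_adeleAddCharAt)

namespace Summit.HodgeConjecture.HodgeConjecture.Cruxes.HLiu418.K2LiuKindOneLineLatticeLocalPrelims

variable (L : Type) [Field L] [NumberField L] [IsCMField L]

/-! ## §1 Unit defects of a non-zero scalar of `L`, place by place -/

omit [IsCMField L] in
/-- **THE UNIT DEFECT OF `x ≠ 0`**: natural numbers `c_x(w)`, zero for almost all `w` (★ `eventually_valued_algebraMap_eq_one`), with `exp(−c_x(w)) ≤ |x|_w ≤ exp(c_x(w))`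
(`c_x(w) := |ord_w x|`). [cite: CasselsFrohlichANT1967, Ch. II §4] -/
theorem exists_defect {x : L} (hx : x ≠ 0) :
    ∃ cx : HeightOneSpectrum (𝓞 L) → ℕ, (∀ᶠ w in cofinite, cx w = 0) ∧
      ∀ w : HeightOneSpectrum (𝓞 L), Valued.v ((x : L) : w.adicCompletion L) ≤ WithZero.exp (cx w : ℤ) ∧
        WithZero.exp (-(cx w : ℤ)) ≤ Valued.v ((x : L) : w.adicCompletion L) := by
  refine ⟨fun w => (WithZero.log (Valued.v ((x : L) : w.adicCompletion L))).natAbs, ?_, fun w => ?_⟩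
  · filter_upwards [UnitaryGroup.eventually_valued_algebraMap_eq_one (E := L) hx] with w hw
    rw [HeightOneSpectrum.algebraMap_adicCompletion, Function.comp_apply, Algebra.algebraMap_self, RingHom.id_apply] at hw
    rw [hw, WithZero.log_one, Int.natAbs_zero]
  · dsimp only
    have hne : Valued.v ((x : L) : w.adicCompletion L) ≠ 0 := by
      rw [HeightOneSpectrum.valuedAdicCompletion_eq_valuation']
      exact (Valuation.ne_zero_iff _).2 hx
    have hk : Valued.v ((x : L) : w.adicCompletion L) = WithZero.exp (WithZero.log (Valued.v ((x : L) : w.adicCompletion L))) :=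
      (WithZero.exp_log hne).symm
    refine ⟨?_, ?_⟩
    · conv_lhs => rw [hk]
      exact WithZero.exp_le_exp.2 (Int.le_natAbs)
    · conv_rhs => rw [hk]
      exact WithZero.exp_le_exp.2 (by omega)

/-! ## §2 The conductor exponents of Tate's local characters `ψ_v`, zero almost everywhere -/

omit [IsCMField L] in
/-- **CONDUCTOR EXPONENTS**: `d : v ↦ ℤ` with `ψ_{L⁺,v}` of conductor exponent `d_v` for every `v` (★ `exists_hasConductorExp_adeleAddCharAt`) and `d_v = 0` for almost all `v`
(★ Tate `Tate1950_adicComponent_adeleAddChar_holds`; `ψ_{L⁺,v}` IS the `v`-component, `rfl`). [cite: Tate1950, §2.2, §4.1] -/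
theorem exists_conductorExp (F : Type) [Field F] [NumberField F] :
    ∃ d : HeightOneSpectrum (𝓞 F) → ℤ, (∀ᶠ v in cofinite, d v = 0) ∧ ∀ v : HeightOneSpectrum (𝓞 F), (adeleAddCharAt F v).HasConductorExp (d v) := by
  classical
  choose d0 hd0 using fun v : HeightOneSpectrum (𝓞 F) => exists_hasConductorExp_adeleAddCharAt F v
  refine ⟨fun v => if (adeleAddCharAt F v).HasConductorExp 0 then 0 else d0 v, ?_, fun v => ?_⟩
  · filter_upwards [(Tate1950_adicComponent_adeleAddChar_holds F).2] with v hv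
    have hv' : (adeleAddCharAt F v).HasConductorExp 0 := hv
    simp only [hv', if_true]
  · by_cases h : (adeleAddCharAt F v).HasConductorExp 0
    · simp only [h, if_true]
    · simp only [h, if_false]
      exact hd0 v

/-! ## §3 The ramification index of a place of `L` over `L⁺` is at most `2` -/

/-- `e(w|v) ≤ [L : L⁺] = 2` (Mathlib `Ideal.ramificationIdx_le_finrank`, ★ `Algebra.IsQuadraticExtension.finrank_eq_two`). [cite: CasselsFrohlichANT1967, Ch. I §5 Prop. 2] -/
theorem ramificationIdx_le_two (v : HeightOneSpectrum (𝓞 (Fp L))) (w : UnitaryGroup.PlacesOver L v) :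
    v.asIdeal.ramificationIdx' w.1.asIdeal ≤ 2 := by
  haveI := UnitaryGroup.PlacesOver.liesOver w
  haveI := v.isMaximal
  haveI : NoZeroSMulDivisors (𝓞 (Fp L)) (𝓞 L) := ⟨fun h => smul_eq_zero.mp h⟩
  rw [← Algebra.IsQuadraticExtension.finrank_eq_two (Fp L) L]
  exact Ideal.ramificationIdx_le_finrank (𝓞 L) (Fp L) L w.1.asIdeal

/-! ## §4 The Gram letters at a place `v` (rank `2`) -/

section Gram

variable {N M : ℕ} (e : Fin N × Fin M ≃ Fin 2)
  (dV : Fin N → L) (hdV : ∀ i, IsCMField.complexConj L (dV i) = dV i)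
  (dW : Fin M → L) (hdW : ∀ i, IsCMField.complexConj L (dW i) = dW i)
  (v : HeightOneSpectrum (𝓞 (Fp L)))

/-- **THE SKEW RELATION OF THE INDEX, READ OVER `L ⊗ L⁺_v`**: `(σ S′)ᵀ·G + G·S′ = 0` for `S′ := S ⊗ 1`, `G := gramS` (the `hS` letter of ★ p863515; pattern of
★ `K2LiuKindWGoodPlaceFactor.beta_skew`, `G = (T^R ⊗ L) ⊗ 1` by ★ `K2LiuKindWGoodPlaceFactor.gramS_eq_map`). [cite: Shimura1997, §18.1] -/
theorem skew_map (S : skewMatrices ((IsCMField.complexConj L : L ≃ₐ[Fp L] L) : L →+* L) ((gramR L e dV hdV dW hdW).map (algebraMap (Fp L) L))) :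
    (((S : Matrix (Fin 2) (Fin 2) L).map (algebraMap L (LocalRing L v))).map (conjLocal L (IsCMField.complexConj L) v))ᵀ *
          LocalSplitting.gramS (Fp L) L v 2 (gramR L e dV hdV dW hdW) +
        LocalSplitting.gramS (Fp L) L v 2 (gramR L e dV hdV dW hdW) * (S : Matrix (Fin 2) (Fin 2) L).map (algebraMap L (LocalRing L v)) = 0 := by
  have h0 := (mem_skewMatrices_iff _ _ _).1 S.2
  have h1 := congrArg (RingHom.mapMatrix (algebraMap L (LocalRing L v))) h0
  rw [map_add, map_mul, map_mul, map_zero, RingHom.mapMatrix_apply, RingHom.mapMatrix_apply, RingHom.mapMatrix_apply] at h1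
  have hconj : (((S : Matrix (Fin 2) (Fin 2) L).map ((IsCMField.complexConj L : L ≃ₐ[Fp L] L) : L →+* L))ᵀ).map (algebraMap L (LocalRing L v)) =
      (((S : Matrix (Fin 2) (Fin 2) L).map (algebraMap L (LocalRing L v))).map (conjLocal L (IsCMField.complexConj L) v))ᵀ := by
    ext i j
    simp only [Matrix.map_apply, Matrix.transpose_apply, RingHom.coe_coe, conjLocal_algebraMap]
  rw [hconj, ← K2LiuKindWGoodPlaceFactor.gramS_eq_map L e dV hdV dW hdW v] at h1
  rw [add_comm]
  exact h1

/-- the diagonal Gram entries as scalars of `L`: `T^R_{kk} ⊗ 1`, non-zero when all `dV`, `dW` are (★ `gramR_eq_diagonal`). [cite: HarrisKudlaSweet1996, §1 (1.9)] -/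
theorem gramR_diag_ne_zero (hdV0 : ∀ i, dV i ≠ 0) (hdW0 : ∀ i, dW i ≠ 0) (k : Fin 2) :
    (gramR L e dV hdV dW hdW k k : Fp L) ≠ 0 := by
  rw [gramR_eq_diagonal, Matrix.diagonal_apply_eq]
  intro h
  have h' := congrArg (fun z : Fp L => (z : L)) h
  simp only [MulMemClass.coe_mul, ZeroMemClass.coe_zero] at h'
  exact mul_ne_zero (hdV0 _) (hdW0 _) h'

/-- the off-diagonal Gram entries vanish (★ `gramR_eq_diagonal`). [cite: HarrisKudlaSweet1996, §1 (1.9)] -/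
theorem gramR_offDiag {k l : Fin 2} (hkl : k ≠ l) : gramR L e dV hdV dW hdW k l = 0 := by
  rw [gramR_eq_diagonal, Matrix.diagonal_apply_ne _ hkl]

/-- `gramS_{kl} = ι_v (T^R_{kl})` (unfolding the `abbrev`). [cite: HarrisKudlaSweet1996, §1 (1.9)] -/
theorem gramS_apply (k l : Fin 2) :
    LocalSplitting.gramS (Fp L) L v 2 (gramR L e dV hdV dW hdW) k l = toLocalRing L v ((gramR L e dV hdV dW hdW k l : Fp L) : v.adicCompletion (Fp L)) := rfl

end Gram

/-! ## §5 The test step: a deep skew test block gives a deep local Siegel unipotent in `N_Δ(𝔸)`, on which `χ_S` reads `ψ_v(Tr(−½·tr(S t)))` -/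

section Test

variable {N M : ℕ} (e : Fin N × Fin M ≃ Fin 2)
  (dV : Fin N → L) (hdV : ∀ i, IsCMField.complexConj L (dV i) = dV i)
  (dW : Fin M → L) (hdW : ∀ i, IsCMField.complexConj L (dW i) = dW i)
  (v : HeightOneSpectrum (𝓞 (Fp L)))

omit [IsCMField L] in
/-- currency: `|z|_w ≤ |2|_w · exp(−M)` ⟹ `valuation z ≤ valuation 2 · valuation ϖ_w ^ M` (★ `valued_unifAt`, ★ `v_le_iff_valuation_le`). [cite: PlatonovRapinchuk1994, §5.1] -/
theorem valuation_le_two_mul_pow_of_valued_le (w : HeightOneSpectrum (𝓞 L)) (Mv : ℕ) {z : w.adicCompletion L}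
    (hz : Valued.v z ≤ Valued.v ((2 : L) : w.adicCompletion L) * WithZero.exp (-(Mv : ℤ))) :
    valuation (w.adicCompletion L) z ≤
      valuation (w.adicCompletion L) (2 : w.adicCompletion L) * valuation (w.adicCompletion L) (unifAt L w) ^ Mv := by
  have h2 : ((2 : L) : w.adicCompletion L) = 2 := map_ofNat (algebraMap L (w.adicCompletion L)) 2
  have h1 : Valued.v z ≤ Valued.v ((2 : w.adicCompletion L) * unifAt L w ^ Mv) := by
    rw [map_mul, map_pow, valued_unifAt, ← WithZero.exp_nsmul, smul_neg, nsmul_eq_mul, mul_one, ← h2]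
    exact hz
  have h3 := (v_le_iff_valuation_le _ _).1 h1
  rwa [map_mul, map_pow] at h3

/-- **THE TEST STEP.**  If `χ_S(ι_v u) = 1` for every `u ∈ H(L⁺_v)` with all components in `K_{w′}(ϖ_{w′}^{Mv})` and `ι_v u ∈ N_Δ(𝔸)` (the premise of `hloc`), then for
every `T^R`-skew block `t` over `L ⊗ L⁺_v` whose `w′`-entries satisfy `|t_{ij}|_{w′} ≤ |2|_{w′}·exp(−Mv)` at every `w′ ∣ v`:
`ψ_v(Tr(−½·tr((S ⊗ 1)·t))) = 1` — `u := n(t)` is deep at every place (★ (lat-a) ED.2 `nElem_apply_mem_congruenceGL_pow_of_two`), lies in `N_Δ(𝔸)`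
(★ `nElem_mem_unipDeltaLocal` + ★ `mem_unipDeltaLoc_iff_mem_unipDeltaLocal` + ★ `locToAdelic_mem_unipDelta`), and `χ_S(ι_v n(t))` is read by ★ `unipDeltaChar_locToAdelic_nElem`.
[cite: Shimura1997, §18.4] [cite: MoeglinWaldspurger1995, I.2.6] -/
theorem addChar_trace_eq_one_of_prem (Mv : ℕ) (S : Matrix (Fin 2) (Fin 2) L)
    (hprem : ∀ u : UnitaryGroup.localPi L (IsCMField.complexConj L) (2 + 2) (hermD L e dV hdV dW hdW) v,
        (∀ w' : UnitaryGroup.PlacesOver L v,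
          (u : UnitaryGroup.LocalGLPi L (2 + 2) v) w' ∈ congruenceGL (2 + 2) (valuation (w'.1.adicCompletion L) (unifAt L w'.1) ^ Mv)) →
        (locToAdelic L e dV hdV dW hdW v u : HA L e dV hdV dW hdW) ∈ unipDelta L e dV hdV dW hdW →
        unipDeltaChar L e dV hdV dW hdW S (locToAdelic L e dV hdV dW hdW v u) = 1)
    {t : Matrix (Fin 2) (Fin 2) (LocalRing L v)}
    (ht : (t.map (conjLocal L (IsCMField.complexConj L) v))ᵀ * LocalSplitting.gramS (Fp L) L v 2 (gramR L e dV hdV dW hdW) +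
      LocalSplitting.gramS (Fp L) L v 2 (gramR L e dV hdV dW hdW) * t = 0)
    (hdeep : ∀ (w' : UnitaryGroup.PlacesOver L v) (i j : Fin 2),
      Valued.v (t i j w') ≤ Valued.v ((2 : L) : w'.1.adicCompletion L) * WithZero.exp (-(Mv : ℤ))) :
    adeleAddCharAt (Fp L) v (Algebra.trace (v.adicCompletion (Fp L)) (LocalRing L v)
      (-(⅟(2 : LocalRing L v) * Matrix.trace (S.map (algebraMap L (LocalRing L v)) * t)))) = 1 := by
  have key : unipDeltaChar L e dV hdV dW hdW S (locToAdelic L e dV hdV dW hdW v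
      (nElem (Fp L) L (IsCMField.complexConj L) v 2 (hermD_eq_map_gramD L e dV hdV dW hdW) t ht)) = 1 := by
    refine hprem _ (fun w' => ?_) ?_
    · exact nElem_apply_mem_congruenceGL_pow_of_two (Fp L) L (IsCMField.complexConj L) v 2 (hermD_eq_map_gramD L e dV hdV dW hdW) ht
        (valuation_unifAt_le_one L w'.1) Mv fun i j => valuation_le_two_mul_pow_of_valued_le L w'.1 Mv (hdeep w' i j)
    · exact locToAdelic_mem_unipDelta L e dV hdV dW hdW
        ((mem_unipDeltaLoc_iff_mem_unipDeltaLocal L e dV hdV dW hdW v _).2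
          (nElem_mem_unipDeltaLocal (F := Fp L) (E := L) (c := IsCMField.complexConj L) (v := v) (n := 2)
            (hJD := hermD_eq_map_gramD L e dV hdV dW hdW) t ht))
  rwa [unipDeltaChar_locToAdelic_nElem] at key

end Test

/-! ## §6 Valuation bookkeeping for the test entries -/

section Entries

variable (v : HeightOneSpectrum (𝓞 (Fp L)))

omit [IsCMField L] in
/-- `|ι_v(u)·z|_{w′} ≤ exp(−N + B)` when `|u|_v ≤ exp(−N)` (`N ≥ 0`) and `|z|_{w′} ≤ exp B` (`|ι_{w′} u| = |u|^{e(w′|v)} ≤ |u|`, ★ `valued_toPlace_le_exp_mul`).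
[cite: Tate1950, §2.2] -/
theorem valued_toLocalRing_mul_apply_le (w' : UnitaryGroup.PlacesOver L v) {u : v.adicCompletion (Fp L)} {N : ℕ}
    (hu : Valued.v u ≤ WithZero.exp (-(N : ℤ))) {z : LocalRing L v} {B : ℤ} (hz : Valued.v (z w') ≤ WithZero.exp B) :
    Valued.v ((toLocalRing L v u * z) w') ≤ WithZero.exp (-(N : ℤ) + B) := by
  haveI := UnitaryGroup.PlacesOver.liesOver w'
  haveI : NoZeroSMulDivisors (𝓞 (Fp L)) (𝓞 L) := ⟨fun h => smul_eq_zero.mp h⟩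
  have he1 : (1 : ℤ) ≤ v.asIdeal.ramificationIdx' w'.1.asIdeal := by
    exact_mod_cast Nat.one_le_iff_ne_zero.2 (Ideal.IsDedekindDomain.ramificationIdx'_ne_zero_of_liesOver w'.1.asIdeal v.ne_bot)
  have h1 : Valued.v (toPlace v w' u) ≤ WithZero.exp (-(N : ℤ)) := by
    refine (valued_toPlace_le_exp_mul L v w' hu).trans (WithZero.exp_le_exp.2 ?_)
    have : (N : ℤ) ≤ v.asIdeal.ramificationIdx' w'.1.asIdeal * N := le_mul_of_one_le_left (Nat.cast_nonneg N) he1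
    linarith
  rw [Pi.mul_apply, map_mul, toLocalRing_apply, WithZero.exp_add]
  exact mul_le_mul' h1 hz

omit [IsCMField L] in
/-- `|−(A·B·r)|_{w′} ≤ exp(a + b + x)` from the three bounds. [folklore] -/
theorem valued_neg_mul_mul_apply_le (w' : UnitaryGroup.PlacesOver L v) {A B r : LocalRing L v} {a b x : ℤ}
    (hA : Valued.v (A w') ≤ WithZero.exp a) (hB : Valued.v (B w') ≤ WithZero.exp b) (hr : Valued.v (r w') ≤ WithZero.exp x) :
    Valued.v ((-(A * B * r)) w') ≤ WithZero.exp (a + b + x) := by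
  rw [Pi.neg_apply, Valuation.map_neg, Pi.mul_apply, Pi.mul_apply, map_mul, map_mul, WithZero.exp_add, WithZero.exp_add]
  exact mul_le_mul' (mul_le_mul' hA hB) hr

omit [NumberField L] [IsCMField L] in
/-- `V⁻¹ ≤ exp c` from `exp(−c) ≤ V` (in `ℤᵐ⁰`). [folklore] -/
theorem inv_le_exp_of_exp_neg_le {V : WithZero (Multiplicative ℤ)} {c : ℤ} (h : WithZero.exp (-c) ≤ V) : V⁻¹ ≤ WithZero.exp c := by
  have hV : V ≠ 0 := by
    rintro rfl
    exact WithZero.coe_ne_zero (le_zero_iff.1 h)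
  rw [WithZero.exp_neg] at h
  exact (inv_le_comm₀ (zero_lt_iff.2 hV) (zero_lt_iff.2 WithZero.coe_ne_zero)).2 h

omit [NumberField L] [IsCMField L] in
/-- the final depth comparison: `V ≤ exp T`, `exp(−c₂) ≤ |2|`, `T ≤ −c₂ − Mv` ⟹ `V ≤ |2|·exp(−Mv)`. [folklore] -/
theorem le_two_mul_exp_of_le {V V2 : WithZero (Multiplicative ℤ)} {Mv c₂ : ℕ} {T : ℤ}
    (h : V ≤ WithZero.exp T) (h2 : WithZero.exp (-(c₂ : ℤ)) ≤ V2) (hle : T ≤ -(c₂ : ℤ) - Mv) :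
    V ≤ V2 * WithZero.exp (-(Mv : ℤ)) := by
  refine h.trans ((WithZero.exp_le_exp.2 (show T ≤ -(c₂ : ℤ) + -(Mv : ℤ) by omega)).trans ?_)
  rw [WithZero.exp_add]
  exact mul_le_mul' h2 le_rfl

omit [NumberField L] [IsCMField L] in
/-- `1 ≤ exp n` for `n : ℕ`. [folklore] -/
theorem one_le_exp_natCast (n : ℕ) : (1 : WithZero (Multiplicative ℤ)) ≤ WithZero.exp (n : ℤ) := by
  rw [← WithZero.exp_zero]
  exact WithZero.exp_le_exp.2 (by positivity)

omit [IsCMField L] in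
/-- `|0|_{w′} ≤ γ`. [folklore] -/
theorem valued_zero_apply_le {v : HeightOneSpectrum (𝓞 (Fp L))} (w' : UnitaryGroup.PlacesOver L v) (γ : WithZero (Multiplicative ℤ)) :
    Valued.v ((0 : LocalRing L v) w') ≤ γ := by
  rw [Pi.zero_apply, map_zero]
  exact zero_le

/-- over `v`, a place is `w` or `c⁻¹ • w` (★ `PlacesOver.eq_or_eq_galInv`): `f(w′) ≤ f(w) + f(c⁻¹ • w)` for every `f : w ↦ ℕ`. [cite: CasselsFrohlichANT1967, Ch. VII Prop. 1.2 (ii)] -/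
theorem apply_le_of_placesOver (f : HeightOneSpectrum (𝓞 L) → ℕ) {v : HeightOneSpectrum (𝓞 (Fp L))} (w w' : UnitaryGroup.PlacesOver L v) :
    f w'.1 ≤ f w.1 + f ((IsCMField.complexConj L)⁻¹ • w.1) := by
  rcases PlacesOver.eq_or_eq_galInv (F := Fp L) (E := L) (IsCMField.complexConj L) (IsCMField.complexConj_ne_one L) w w' with rfl | rfl
  · exact Nat.le_add_right _ _
  · exact Nat.le_add_left _ _

omit [NumberField L] [IsCMField L] in
/-- the final OUTPUT comparison: `|2||δ||S| ≤ max(|δ|,1)·exp X` with the unit defects `exp(−c₂) ≤ |2|`, `exp(−c_δ) ≤ |δ| ≤ exp(c_δ)` and `c₂ + 2c_δ + X ≤ Y`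
⟹ `|S| ≤ exp Y`. [folklore] -/
theorem le_exp_of_mul_mul_le {V2 Vδ VS : WithZero (Multiplicative ℤ)} {c₂ cδ : ℕ} {X Y : ℤ}
    (h2 : WithZero.exp (-(c₂ : ℤ)) ≤ V2) (hδlo : WithZero.exp (-(cδ : ℤ)) ≤ Vδ) (hδhi : Vδ ≤ WithZero.exp (cδ : ℤ))
    (h : V2 * Vδ * VS ≤ max Vδ 1 * WithZero.exp X) (hXY : (c₂ : ℤ) + 2 * cδ + X ≤ Y) : VS ≤ WithZero.exp Y := by
  have hmax : max Vδ 1 ≤ WithZero.exp (cδ : ℤ) :=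
    max_le hδhi (by rw [← WithZero.exp_zero]; exact WithZero.exp_le_exp.2 (by positivity))
  have h1 : WithZero.exp (-(c₂ : ℤ) + -(cδ : ℤ)) * VS ≤ WithZero.exp ((cδ : ℤ) + X) := by
    rw [WithZero.exp_add, WithZero.exp_add]
    exact (mul_le_mul' (mul_le_mul' h2 hδlo) le_rfl).trans (h.trans (mul_le_mul' hmax le_rfl))
  calc VS = WithZero.exp ((c₂ : ℤ) + cδ) * (WithZero.exp (-(c₂ : ℤ) + -(cδ : ℤ)) * VS) := by
        rw [← mul_assoc, ← WithZero.exp_add, show (c₂ : ℤ) + cδ + (-(c₂ : ℤ) + -(cδ : ℤ)) = 0 by ring, WithZero.exp_zero, one_mul]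
    _ ≤ WithZero.exp ((c₂ : ℤ) + cδ) * WithZero.exp ((cδ : ℤ) + X) := mul_le_mul' le_rfl h1
    _ = WithZero.exp ((c₂ : ℤ) + 2 * cδ + X) := by rw [← WithZero.exp_add]; congr 1; ring
    _ ≤ WithZero.exp Y := WithZero.exp_le_exp.2 hXY

omit [NumberField L] [IsCMField L] in
/-- `e·(N − d) ≤ 2N + 2|d|` for `0 ≤ e ≤ 2`, `0 ≤ N`. [folklore] -/
theorem ramification_slack {e N d : ℤ} (he0 : 0 ≤ e) (he : e ≤ 2) (hN : 0 ≤ N) : e * (N - d) ≤ 2 * N + 2 * (d.natAbs : ℤ) := by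
  rcases le_or_gt 0 (N - d) with h | h
  · have h1 : e * (N - d) ≤ 2 * (N - d) := mul_le_mul_of_nonneg_right he h
    omega
  · have h1 : e * (N - d) ≤ 0 := mul_nonpos_of_nonneg_of_nonpos he0 h.le
    omega

omit [NumberField L] [IsCMField L] in
/-- entries of a `2 × 2` literal. [folklore] -/
theorem forall_fin_two_apply {α : Type*} (P : α → Prop) {a b c d : α} (ha : P a) (hb : P b) (hc : P c) (hd : P d) :
    ∀ i j : Fin 2, P ((!![a, b; c, d] : Matrix (Fin 2) (Fin 2) α) i j) := by
  intro i j
  fin_cases i <;> fin_cases j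
  · exact ha
  · exact hb
  · exact hc
  · exact hd

end Entries

end Summit.HodgeConjecture.HodgeConjecture.Cruxes.HLiu418.K2LiuKindOneLineLatticeLocalPrelims

end
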